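import Literature.NumberTheory.EllipticCurves.EichlerShimuraPeriodsGamma1
import Mathlib.NumberTheory.ModularForms.Bounds
import Mathlib.Algebra.Order.Chebyshev
import HarnessLib

/-!
# The trivial bound for the eigenvalues of `T_p` on `S_k(Γ₁(N))`: `|λ|² ≤ (p + 1)² p^{k-2}`

A proofs-only file (theorems only; no definition, no named fact; D-0026).  For a prime `p` and an
eigenvector `f ≠ 0` of the Hecke operator `T_p` on `S_k(Γ₁(N))` with eigenvalue `λ`
(`heckeT (Gamma1 N) k p f = λ • f`, arithmetic normalisation
`a_n(T_p f) = a_{pn}(f) + p^{k-1} a_{n/p}(⟨p⟩ f)`), we prove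

  `‖λ‖ ^ 2 ≤ (p + 1) ^ 2 * p ^ (k - 2)`     (`norm_sq_le_of_heckeT_gamma1_eq_smul`),

the "trivial" (Hecke) bound `|λ| ≤ (p + 1) p^{k/2 - 1}`.  Proof: the invariant function
`φ_f(τ) = |f(τ)|² (Im τ)^k = ‖petersson k f f τ‖` of a cusp form is bounded on `ℍ`
(Mathlib `CuspFormClass.petersson_bounded_left`); let `M = sup φ_f > 0`.  By Diamond–Shurman
Prop. 5.2.1, `T_p f = ∑ᵢ (⟨εᵢ⟩ f) ∣_k βᵢ` over at most `p + 1` integer matrices `βᵢ` of determinant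
`p` (`coe_heckeT_gamma1`), and for each term `φ_{g ∣ β}(τ) = p^{k-2} φ_g(β τ) ≤ p^{k-2} M`
(Mathlib `UpperHalfPlane.petersson_slash`; `φ_{⟨d⟩ f} = φ_f ∘ σ_d` has the same supremum).  By
Cauchy–Schwarz, `|λ|² φ_f(τ) = φ_{T_p f}(τ) ≤ (p + 1)² p^{k-2} M` for every `τ`; taking the supremum
over `τ` and dividing by `M` gives the claim.  For `k ≥ 3` the right-hand side is `< (1 + p^{k-1})²`,
the square of the `T_p`-eigenvalue of the weight-`k` Eisenstein series at the cusps above `∞`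
(`p ≡ 1 mod N`) — the separation used in Manin–Drinfeld-type arguments
(`norm_lt_one_add_pow_of_heckeT_gamma1_eq_smul`).

## References

* F. Diamond, J. Shurman, *A first course in modular forms*, GTM 228 (2005): Prop. 5.2.1 (coset
  decomposition of `T_p`), Exercise 5.9.1(a) (`Im(τ)^{k/2}|f(τ)|` is bounded on `ℍ` for a cusp
  form `f ∈ S_k(Γ₁(N))`) and the proof of Prop. 5.9.1 (`|a_n(f)| ≤ C n^{k/2}`); the trivial bound
  suffices here (Deligne's `|a_p| ≤ 2p^{(k-1)/2}` is not needed). [DiamondShurman2005]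
-/

noncomputable section

open scoped MatrixGroups ModularForm

open CongruenceSubgroup UpperHalfPlane Filter

namespace Literature.NumberTheory.EllipticCurves.ModularForms

variable {N : ℕ} [NeZero N] {k : ℤ} {p : ℕ} [NeZero p]

/-- `‖petersson k f f τ‖ = ‖f τ‖² (Im τ)^k`. [folklore] -/
theorem norm_petersson_self (k : ℤ) (f : ℍ → ℂ) (τ : ℍ) :
    ‖petersson k f f τ‖ = ‖f τ‖ ^ 2 * τ.im ^ k := by
  rw [petersson, norm_mul, norm_mul, Complex.norm_conj, ← Complex.ofReal_zpow, Complex.norm_real,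
    Real.norm_of_nonneg (zpow_nonneg τ.im_pos.le k), sq]

/-- For an integer matrix `β` of determinant `p` (as an element of `GL(2, ℝ)⁺`) and any
`g : ℍ → ℂ`: `‖(g ∣_k β)(τ)‖² (Im τ)^k = p^{k-2} ‖g(βτ)‖² (Im βτ)^k`. [folklore] -/
theorem norm_petersson_self_slash_intGL_heckeRep (k : ℤ) (g : ℍ → ℂ) (i : Option (ZMod p)) (τ : ℍ) :
    ‖petersson k (g ∣[k] intGL (heckeRep p i)) (g ∣[k] intGL (heckeRep p i)) τ‖ =
      (p : ℝ) ^ (k - 2) * ‖petersson k g g (intGL (heckeRep p i) • τ)‖ := by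
  rw [petersson_slash, norm_mul, norm_σ, det_intGL_val (det_heckeRep_ne_zero (NeZero.ne p) i),
    det_heckeRep, norm_zpow, Complex.norm_real, Real.norm_of_nonneg (abs_nonneg _), Int.cast_natCast,
    Nat.abs_cast]

/-- `φ_{⟨d⟩ f} = φ_f ∘ σ_d`: the diamond twist of `f` has the same invariant function up to a
translation of the argument. [folklore] -/
theorem norm_petersson_self_diamondOp (σ : Gamma0 N) (f : CuspForm (Gamma1 N) k) (τ : ℍ) :
    ‖petersson k (⇑(diamondOp N k (Gamma0Map N σ) f)) (⇑(diamondOp N k (Gamma0Map N σ) f)) τ‖ =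
      ‖petersson k (⇑f) (⇑f) ((σ : SL(2, ℤ)) • τ)‖ := by
  rw [coe_diamondOp_eq_slash, ← ModularForm.SL_slash, petersson_slash_SL]

/-- **The trivial bound for Hecke eigenvalues on `S_k(Γ₁(N))`**: if `f ≠ 0` and `T_p f = λ f`
(`p` prime) then `‖λ‖² ≤ (p + 1)² p^{k-2}`, i.e. `|λ| ≤ (p + 1) p^{k/2 - 1}`.
[cite: DiamondShurman2005, Prop. 5.2.1 and Exercise 5.9.1(a)] -/
theorem norm_sq_le_of_heckeT_gamma1_eq_smul (hp : p.Prime) {f : CuspForm (Gamma1 N) k} (hf : f ≠ 0)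
    {c : ℂ} (hc : heckeT (Gamma1 N) k p f = c • f) :
    ‖c‖ ^ 2 ≤ ((p : ℝ) + 1) ^ 2 * (p : ℝ) ^ (k - 2) := by
  classical
  -- the bounded invariant function `φ_f(τ) = ‖petersson k f f τ‖` and its supremum `M > 0`
  set P : ℍ → ℝ := fun τ ↦ ‖petersson k (⇑f) (⇑f) τ‖ with hP
  obtain ⟨C, hC⟩ := CuspFormClass.petersson_bounded_left k (Gamma1 N : Subgroup (GL (Fin 2) ℝ)) f f
  have hbdd : BddAbove (Set.range P) := ⟨C, by rintro _ ⟨τ, rfl⟩; exact hC τ⟩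
  set M : ℝ := ⨆ τ, P τ with hM
  have hPM : ∀ τ, P τ ≤ M := fun τ ↦ le_ciSup hbdd τ
  obtain ⟨τ₀, hτ₀⟩ : ∃ τ₀, f τ₀ ≠ 0 := by
    by_contra h
    push Not at h
    exact hf (CuspForm.ext fun τ ↦ by rw [h τ, CuspForm.zero_apply])
  have hMpos : 0 < M := by
    refine lt_of_lt_of_le ?_ (hPM τ₀)
    simp only [hP, norm_petersson_self]
    exact mul_pos (pow_pos (norm_pos_iff.mpr hτ₀) 2) (zpow_pos τ₀.im_pos k)
  -- each translate: `φ_{(⟨εᵢ⟩ f) ∣ βᵢ}(τ) ≤ p^{k-2} M`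
  have hterm : ∀ (i : HeckeIdx N p) (τ : ℍ),
      ‖(⇑(diamondOp N k (heckeEps N p i.1) f) ∣[k] intGL (heckeRep p i.1)) τ‖ ^ 2 * τ.im ^ k ≤
        (p : ℝ) ^ (k - 2) * M := by
    intro i τ
    obtain ⟨σ, hσ⟩ := exists_gamma0Map_eq_holds N (isUnit_heckeEps hp i)
    rw [← hσ, ← norm_petersson_self, norm_petersson_self_slash_intGL_heckeRep,
      norm_petersson_self_diamondOp]
    exact mul_le_mul_of_nonneg_left (hPM _) (zpow_nonneg (Nat.cast_nonneg p) _)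
  -- Cauchy–Schwarz: `|λ|² φ_f(τ) ≤ #I · ∑ᵢ φᵢ(τ) ≤ #I² p^{k-2} M`
  set I : ℝ := ((Fintype.card (HeckeIdx N p) : ℕ) : ℝ) with hI
  have hIle : I ≤ (p : ℝ) + 1 := by
    have h := Fintype.card_subtype_le (fun i : Option (ZMod p) ↦ i = none → ¬ p ∣ N)
    rw [Fintype.card_option, ZMod.card] at h
    rw [hI]
    exact_mod_cast h
  have hI0 : 0 ≤ I := by rw [hI]; exact Nat.cast_nonneg _
  have hpoint : ∀ τ : ℍ, ‖c‖ ^ 2 * P τ ≤ I ^ 2 * ((p : ℝ) ^ (k - 2) * M) := by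
    intro τ
    have hTf : ‖heckeT (Gamma1 N) k p f τ‖ = ‖c‖ * ‖f τ‖ := by
      rw [hc, CuspForm.IsGLPos.coe_smul, Pi.smul_apply, smul_eq_mul, norm_mul]
    have hsum : ‖heckeT (Gamma1 N) k p f τ‖ ≤
        ∑ i : HeckeIdx N p, ‖(⇑(diamondOp N k (heckeEps N p i.1) f) ∣[k] intGL (heckeRep p i.1)) τ‖ := by
      rw [coe_heckeT_gamma1 N k p hp f, Finset.sum_apply]
      exact norm_sum_le _ _
    have hCS := sq_sum_le_card_mul_sum_sq (s := (Finset.univ : Finset (HeckeIdx N p)))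
      (f := fun i : HeckeIdx N p ↦
        ‖(⇑(diamondOp N k (heckeEps N p i.1) f) ∣[k] intGL (heckeRep p i.1)) τ‖)
    rw [Finset.card_univ] at hCS
    have hk0 : 0 ≤ τ.im ^ k := zpow_nonneg τ.im_pos.le k
    calc ‖c‖ ^ 2 * P τ = ‖heckeT (Gamma1 N) k p f τ‖ ^ 2 * τ.im ^ k := by
          simp only [hP, norm_petersson_self, hTf]; ring
      _ ≤ (∑ i : HeckeIdx N p,
            ‖(⇑(diamondOp N k (heckeEps N p i.1) f) ∣[k] intGL (heckeRep p i.1)) τ‖) ^ 2 * τ.im ^ k :=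
          mul_le_mul_of_nonneg_right (pow_le_pow_left₀ (norm_nonneg _) hsum 2) hk0
      _ ≤ (I * ∑ i : HeckeIdx N p,
            ‖(⇑(diamondOp N k (heckeEps N p i.1) f) ∣[k] intGL (heckeRep p i.1)) τ‖ ^ 2) * τ.im ^ k :=
          mul_le_mul_of_nonneg_right hCS hk0
      _ = I * ∑ i : HeckeIdx N p,
            ‖(⇑(diamondOp N k (heckeEps N p i.1) f) ∣[k] intGL (heckeRep p i.1)) τ‖ ^ 2 * τ.im ^ k := by
          rw [mul_assoc, Finset.sum_mul]
      _ ≤ I * ∑ _i : HeckeIdx N p, (p : ℝ) ^ (k - 2) * M :=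
          mul_le_mul_of_nonneg_left (Finset.sum_le_sum fun i _ ↦ hterm i τ) hI0
      _ = I ^ 2 * ((p : ℝ) ^ (k - 2) * M) := by
          rw [Finset.sum_const, Finset.card_univ, nsmul_eq_mul, ← hI]; ring
  -- take the supremum over `τ` and divide by `M`
  have hB0 : 0 ≤ I ^ 2 * ((p : ℝ) ^ (k - 2) * M) := by positivity
  have hcM : ‖c‖ ^ 2 * M ≤ I ^ 2 * ((p : ℝ) ^ (k - 2) * M) := by
    rcases eq_or_lt_of_le (sq_nonneg ‖c‖) with h0 | hcpos
    · rw [← h0, zero_mul]; exact hB0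
    · have : M ≤ I ^ 2 * ((p : ℝ) ^ (k - 2) * M) / ‖c‖ ^ 2 :=
        ciSup_le fun τ ↦ by rw [le_div_iff₀ hcpos, mul_comm]; exact hpoint τ
      rwa [le_div_iff₀ hcpos, mul_comm] at this
  have h1 : ‖c‖ ^ 2 ≤ I ^ 2 * (p : ℝ) ^ (k - 2) := by
    have := hcM
    rw [← mul_assoc] at this
    exact le_of_mul_le_mul_right this hMpos
  calc ‖c‖ ^ 2 ≤ I ^ 2 * (p : ℝ) ^ (k - 2) := h1
    _ ≤ ((p : ℝ) + 1) ^ 2 * (p : ℝ) ^ (k - 2) :=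
        mul_le_mul_of_nonneg_right (pow_le_pow_left₀ hI0 hIle 2) (zpow_nonneg (Nat.cast_nonneg p) _)

/-- The elementary inequality `(p + 1)² p^{k-2} < (1 + p^{k-1})²` for `p ≥ 2`, `k ≥ 3`. [folklore] -/
theorem add_one_sq_mul_pow_lt {p : ℕ} (hp : 2 ≤ p) {k : ℤ} (hk : 3 ≤ k) :
    ((p : ℝ) + 1) ^ 2 * (p : ℝ) ^ (k - 2) < (1 + (p : ℝ) ^ (k - 1)) ^ 2 := by
  obtain ⟨m, rfl⟩ : ∃ m : ℕ, k = (m : ℤ) + 3 := ⟨(k - 3).toNat, by omega⟩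
  have hp1 : (1 : ℝ) ≤ p := by exact_mod_cast (by omega : 1 ≤ p)
  have hp2 : (2 : ℝ) ≤ p := by exact_mod_cast hp
  rw [show (m : ℤ) + 3 - 2 = ((m + 1 : ℕ) : ℤ) by push_cast; ring,
    show (m : ℤ) + 3 - 1 = ((m + 2 : ℕ) : ℤ) by push_cast; ring, zpow_natCast, zpow_natCast]
  -- `(p+1)² p^{m+1} < (1 + p^{m+2})²`: since `(p+1)² ≤ p³ + 1 + 2p^? …` we use `(p+1)² p^{m+1} ≤ p^{m+4}`? No:
  -- `(p+1)² ≤ 2p² + 2 ≤ p³` fails for `p = 2` (`9 > 8`); instead compare with `p^{2m+4} + 2p^{m+2}`.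
  have hq : 0 ≤ (p : ℝ) ^ (m + 1) := by positivity
  have key : ((p : ℝ) + 1) ^ 2 * (p : ℝ) ^ (m + 1) ≤ (p : ℝ) ^ (2 * m + 4) + 2 * (p : ℝ) ^ (m + 2) := by
    -- `(p+1)² p^{m+1} = p^{m+3} + 2p^{m+2} + p^{m+1}` and `p^{m+3} + p^{m+1} ≤ p^{2m+4}`
    have h1 : (p : ℝ) ^ (m + 3) + (p : ℝ) ^ (m + 1) ≤ (p : ℝ) ^ (2 * m + 4) := by
      have h2 : (p : ℝ) ^ (m + 3) + (p : ℝ) ^ (m + 1) ≤ 2 * (p : ℝ) ^ (m + 3) := by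
        have : (p : ℝ) ^ (m + 1) ≤ (p : ℝ) ^ (m + 3) := pow_le_pow_right₀ hp1 (by omega)
        linarith
      have h3 : 2 * (p : ℝ) ^ (m + 3) ≤ (p : ℝ) ^ (m + 4) := by
        rw [pow_succ (p : ℝ) (m + 3)]
        nlinarith [pow_nonneg (zero_le_two.trans hp2) (m + 3)]
      have h4 : (p : ℝ) ^ (m + 4) ≤ (p : ℝ) ^ (2 * m + 4) := pow_le_pow_right₀ hp1 (by omega)
      linarith
    nlinarith [h1, pow_nonneg (zero_le_two.trans hp2) (m + 2), pow_succ (p : ℝ) (m + 1),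
      pow_succ (p : ℝ) (m + 2)]
  have hexp : (1 + (p : ℝ) ^ (m + 2)) ^ 2 = (p : ℝ) ^ (2 * m + 4) + 2 * (p : ℝ) ^ (m + 2) + 1 := by
    ring
  rw [hexp]
  linarith

/-- **Separation from the Eisenstein eigenvalue**: for `k ≥ 3` and `p` prime, every eigenvalue
`λ` of `T_p` on `S_k(Γ₁(N))` satisfies `‖λ‖ < 1 + p^{k-1}` — the `T_p`-eigenvalue
`1 + p^{k-1}` of the weight-`k` Eisenstein series at the cusps above `∞` (`p ≡ 1 mod N`) is not an
eigenvalue of `T_p` on cusp forms. [cite: DiamondShurman2005, Exercise 5.9.1(a) and Prop. 5.2.1] -/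
theorem norm_lt_one_add_pow_of_heckeT_gamma1_eq_smul (hk : 3 ≤ k) (hp : p.Prime)
    {f : CuspForm (Gamma1 N) k} (hf : f ≠ 0) {c : ℂ} (hc : heckeT (Gamma1 N) k p f = c • f) :
    ‖c‖ < 1 + (p : ℝ) ^ (k - 1) := by
  have h1 := norm_sq_le_of_heckeT_gamma1_eq_smul hp hf hc
  have h2 := add_one_sq_mul_pow_lt hp.two_le hk
  have h3 : 0 ≤ 1 + (p : ℝ) ^ (k - 1) := by positivity
  exact lt_of_pow_lt_pow_left₀ 2 h3 (h1.trans_lt h2)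

/-- Consequently **`T_p - (1 + p^{k-1})` is injective (hence invertible) on `S_k(Γ₁(N))`** for
`k ≥ 3` and `p` prime. [folklore] -/
theorem ker_heckeT_gamma1_sub_eq_bot (hk : 3 ≤ k) (hp : p.Prime) :
    LinearMap.ker (heckeT (Gamma1 N) k p - (1 + (p : ℂ) ^ (k - 1)) • LinearMap.id) = ⊥ := by
  rw [LinearMap.ker_eq_bot']
  intro f hf
  by_contra h0
  have hc : heckeT (Gamma1 N) k p f = (1 + (p : ℂ) ^ (k - 1)) • f := by
    have := hf
    rw [LinearMap.sub_apply, LinearMap.smul_apply, LinearMap.id_apply, sub_eq_zero] at this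
    exact this
  have h := norm_lt_one_add_pow_of_heckeT_gamma1_eq_smul hk hp h0 hc
  have hnorm : ‖(1 + (p : ℂ) ^ (k - 1))‖ = 1 + (p : ℝ) ^ (k - 1) := by
    rw [show (1 + (p : ℂ) ^ (k - 1)) = ((1 + (p : ℝ) ^ (k - 1) : ℝ) : ℂ) by push_cast; ring,
      Complex.norm_of_nonneg (by positivity)]
  rw [hnorm] at h
  exact lt_irrefl _ h

end Literature.NumberTheory.EllipticCurves.ModularForms
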